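import Literature.Probability.Percolation.IntRawGood
import Literature.Probability.Percolation.IntFenceGen
import Literature.Probability.Percolation.ArmSeparationIntReroute
import HarnessLib

/-!
# The fence of a term with a stopping set, at an internal extremity (twin of `TrapTermFence.lean`)

Topic `Literature/Probability/Percolation`; family `crit-perc` / near-critical percolation on `𝕋`.
A brick of the INNER half of the near-critical arm-separation theorem for four arms in the ADJACENT
colour arrangement (P. Nolin, EJP 13 (2008), Thm. 11, `j = 4`, `σ = BBWW` [arXiv 0711.4948:
Thm. 10], §4.4 Lemma 15 [arXiv Lemma 14], internal extremities). For the rerouting of two arms of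
one colour along the exploration of the inner half-annulus `intDom m`, every term `c` (tip `z` on the
inner side `x₀ = m`, raw-good at scale `k`, `IntRawOK`) gets a FENCE STOPPED AT `S ⊇ c`:

* `intFenceSet m c z k ω S` — the admissible sites of the connection: open sites of the inner zone
  off `S`, in `above c z` when in the half-annulus (`|v| ≥ m`), strictly above the row of `z` when
  inside `Λ_m`; `mem_intFenceSet_inside`, `mem_intFenceSet_beyond`, `intFenceSet_subset`,
  `intFenceSet_disjoint`, `intFenceSet_box`;
* `IntTermFence m c z k ω S` — the data (fence site `m'` inside `Λ_m` on an open vertical crossing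
  of the corner box, attachment `q ∈ S`, neighbour `p`, tight connection `F`; `p ∈ F` is `T.path.left_mem`);
  `IntRawOK.nonempty_intTermFence`;
* the planar position: `IntTermFence.not_mem_of_subset_below`, `IntRawOK.not_box3_of_offLower`,
  `IntRawOK.not_box17_of_offLower`, `IntTermFence.exists_exit`, `int_sType_or_nType`,
  `int_row_lt_of_nType`, `IntTermFence.not_mem_above_of_row_lt` (F-low), `IntRawOK.row_gap`,
  `IntRawOK.not_box3_of_crossing`, `IntTermFence.not_mem_of_offLower`.

Everything here is proved; no named facts are introduced.

## References

* P. Nolin, Near-critical percolation in two dimensions, *Electron. J. Probab.* 13 (2008), §4.4,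
  proof of Lemma 15, internal extremities (arXiv 0711.4948: Lemma 14; Thm. 10 p. 13) [Nolin2008].
* H. Kesten, Scaling relations for 2D-percolation, *Comm. Math. Phys.* 109 (1987), Lemma 2 [Kesten1987].
-/

noncomputable section

open Set

namespace Literature.Probability.Percolation

open LatticeModels HalfAnnulus

/-- **The admissible sites of the connection of the inner fence of `c` stopped at `S`.** [cite: Nolin2008, §4.4 Lemma 15 (proof), internal extremities (arXiv 0711.4948: Lemma 14)] -/
def intFenceSet (m : ℕ) (c : Finset (Site 2)) (z : Site 2) (k : ℕ) (ω : SiteConfig (Site 2)) (S : Set (Site 2)) : Set (Site 2) :=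
  (intFrameZone m z k ∩
    {v | ((m : ℤ) ≤ triNorm v → v ∈ (intDom m).above c z) ∧ (triNorm v < m → z 1 < v 1)}) ∩ ω ∩ Sᶜ

section FenceSet

variable {m k : ℕ} {c : Finset (Site 2)} {z : Site 2} {ω : SiteConfig (Site 2)} {S : Set (Site 2)} {v : Site 2}

/-- Sites of the fence set are open. [folklore] -/
theorem intFenceSet_subset : intFenceSet m c z k ω S ⊆ ω := fun _ hv => hv.1.2

/-- Sites of the fence set are off `S`. [folklore] -/
theorem intFenceSet_disjoint (hv : v ∈ intFenceSet m c z k ω S) : v ∉ S := hv.2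

/-- Sites of the fence set lie in the square of half-width `2k + 1` about `z`. [folklore] -/
theorem intFenceSet_box (hv : v ∈ intFenceSet m c z k ω S) :
    z 0 - (2 * k + 1) ≤ v 0 ∧ v 0 ≤ z 0 + (2 * k + 1) ∧ z 1 - (2 * k + 1) ≤ v 1 ∧ v 1 ≤ z 1 + (2 * k + 1) :=
  (mem_intFrameZone.1 hv.1.1.1).2

/-- A half-annulus site of the fence set is a site of the domain above `c`, off `c`. [folklore] -/
theorem mem_intFenceSet_inside (hv : v ∈ intFenceSet m c z k ω S) (hn : (m : ℤ) ≤ triNorm v) :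
    v ∈ haFin m ∧ v ∈ (intDom m).above c z ∧ v ∉ c := by
  have ha := hv.1.1.2.1 hn
  have hT : v ∈ haFin m := by
    rcases (mem_intFrameZone.1 hv.1.1.1).1 with h | h
    · rw [← coe_haFin] at h; exact Finset.mem_coe.1 h
    · have := (mem_hinSet.1 h.1).2; omega
  exact ⟨hT, ha, fun hvc => JDomain.not_mem_of_mem_above ha hvc⟩

/-- A site of the fence set inside `Λ_m` lies strictly above the row of `z`. [folklore] -/
theorem mem_intFenceSet_beyond (hv : v ∈ intFenceSet m c z k ω S) (hn : triNorm v < m) : z 1 < v 1 := hv.1.1.2.2 hn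

end FenceSet

/-! ### The data of a stopped inner fence -/

/-- **An inner fence of the term `c` (tip `z`, scale `k`) stopped at `S`** in `ω`: a site `m'`
inside `Λ_m` on an open vertical crossing of the corner box `[z₀-2k, z₀-k] × [z₁+k, z₁+2k]`, an
attachment site `q ∈ S` with a neighbour `p`, and a tight open connection `F ⊆ intFenceSet` from `p`
to `m'`. [cite: Nolin2008, §4.4 Lemma 15 (proof), internal extremities (arXiv 0711.4948: Lemma 14)] [cite: Kesten1987, Lemma 2] -/
structure IntTermFence (m : ℕ) (c : Finset (Site 2)) (z : Site 2) (k : ℕ) (ω : SiteConfig (Site 2)) (S : Set (Site 2)) where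
  /-- the fence site, inside `Λ_m` -/
  m' : Site 2
  /-- the attachment site, in `S` -/
  q : Site 2
  /-- the first site of the connection, a neighbour of `q` -/
  p : Site 2
  /-- the sites of the connection -/
  F : Set (Site 2)
  vcross : OpenVCrossThrough (triStrip (z 0 - 2 * k) (z 1 + k) k k) (z 1 + k) (z 1 + 2 * k) ω m'
  q_mem : q ∈ S
  adj : triGraph.Adj q p
  F_subset : F ⊆ intFenceSet m c z k ω S
  path : PathIn triGraph F p m'
  tight : ∀ x ∈ F, PathIn triGraph F p x

namespace IntTermFence

variable {m k : ℕ} {c : Finset (Site 2)} {z : Site 2} {ω : SiteConfig (Site 2)} {S : Set (Site 2)}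
  (T : IntTermFence m c z k ω S)

/-- `m' ∈ F` (and `p ∈ F` is `T.path.left_mem`). [folklore] -/
theorem m'_mem : T.m' ∈ T.F := T.path.right_mem

/-- Every site of the connection is joined to `m'` inside it. [folklore] -/
theorem pathIn_to_m' {x : Site 2} (hx : x ∈ T.F) : PathIn triGraph T.F x T.m' := (T.tight x hx).symm.trans T.path

/-- The fence site is inside `Λ_m` (it lies in the corner box; `1 ≤ k`, tip on the inner side away
from the corners). [folklore] -/
theorem norm_m' (hk : 1 ≤ k) (hz : IsIntJ m z) (htk : -(m : ℤ) + 2 * k + 1 ≤ z 1 ∧ z 1 ≤ -(2 * (k : ℤ) + 1)) : triNorm T.m' < m := by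
  obtain ⟨e₁, e₂, -, -, hp, -⟩ := T.vcross
  have hm := (hp.right_mem).1
  rw [mem_triStrip] at hm
  obtain ⟨hz0, hz1, hz2⟩ := hz
  have hk' : (1 : ℤ) ≤ k := by exact_mod_cast hk
  rw [triNorm_eq_max]; omega

/-- **The connection avoids every set below `c`.** [folklore] -/
theorem not_mem_of_subset_below {c' : Finset (Site 2)} (hc' : c' ⊆ (intDom m).below c z) {x : Site 2} (hx : x ∈ T.F) : x ∉ c' := by
  intro hxc'
  have hb := JDomain.mem_below.1 (hc' hxc')
  by_cases hn : (m : ℤ) ≤ triNorm x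
  · exact hb.2.2 (mem_intFenceSet_inside (T.F_subset hx) hn).2.1
  · have := (mem_haFin.1 (show x ∈ haFin m from hb.1)).2.1
    omega

/-- **Following the connection into `Λ_m`**: from a half-annulus site `x ∈ F`, the connection
(which ends inside `Λ_m`) reaches a last half-annulus site `x'` adjacent to an inside site `e ∈ F`,
through half-annulus sites of `F` only. [folklore] -/
theorem exists_exit (hk : 1 ≤ k) (hz : IsIntJ m z) (htk : -(m : ℤ) + 2 * k + 1 ≤ z 1 ∧ z 1 ≤ -(2 * (k : ℤ) + 1)) {x : Site 2}
    (hx : x ∈ T.F) (hxn : (m : ℤ) ≤ triNorm x) :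
    ∃ x' e : Site 2, (m : ℤ) ≤ triNorm x' ∧ triNorm e < m ∧ e ∈ T.F ∧ triGraph.Adj x' e ∧
      PathIn triGraph ({v | (m : ℤ) ≤ triNorm v} ∩ T.F) x x' := by
  have hm := T.norm_m' hk hz htk
  obtain ⟨x', e, hx', he, heF, hadj, hpath⟩ :=
    (T.pathIn_to_m' hx).exit (R := {v : Site 2 | (m : ℤ) ≤ triNorm v}) hxn (by simp only [Set.mem_setOf_eq, not_le]; exact hm)
  simp only [Set.mem_setOf_eq, not_le] at hx' he
  exact ⟨x', e, hx', he, heF, hadj, hpath⟩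

end IntTermFence

/-! ### Boundary sites near the tip side: top type or bottom type -/

/-- **A site of the inner boundary on the tip side or the lower side, other than `z'`, is of bottom
type for `z'` or of top type for `z'`.** [folklore] -/
theorem int_sType_or_nType {m : ℕ} {v z' : Site 2} (hv : v ∈ haFin m) (hn : triNorm v = m) (hv0 : v 0 = m ∨ v 1 = -(m : ℤ))
    (hz' : z' ∈ (intDom m).J) (hne : v ≠ z') :
    v ∈ (intDom m).Bt ∪ (intDom m).Jbelow z' ∨ v ∈ (intDom m).Tp ∪ (intDom m).Jabove z' := by
  have hzJ := (mem_intDom_J.1 hz').2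
  obtain ⟨hz0, hz1, hz2⟩ := hzJ
  simp only [Finset.mem_union, mem_intDom_Bt, mem_intDom_Tp, JDomain.mem_Jabove, JDomain.mem_Jbelow, mem_intDom_J]
  rcases hv0 with h0 | h1
  · -- on the tip side
    by_cases hlo : v 1 ≤ -(m : ℤ) + 2
    · exact Or.inl (Or.inl ⟨hv, hn, Or.inr ⟨h0, hlo⟩⟩)
    by_cases hhi : -2 ≤ v 1
    · exact Or.inr (Or.inl ⟨hv, hn, Or.inr ⟨h0, hhi⟩⟩)
    have hvJ : IsIntJ m v := ⟨h0, by omega, by omega⟩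
    rcases lt_trichotomy (v 1) (z' 1) with h | h | h
    · exact Or.inl (Or.inr ⟨⟨hv, hvJ⟩, h⟩)
    · refine absurd ?_ hne
      ext i; fin_cases i
      · exact h0.trans hz0.symm
      · exact h
    · exact Or.inr (Or.inr ⟨⟨hv, hvJ⟩, h⟩)
  · exact Or.inl (Or.inl ⟨hv, hn, Or.inl h1⟩)

/-- **A top-type boundary site on the tip side lies strictly above the row of `z'`.** [folklore] -/
theorem int_row_lt_of_nType {m : ℕ} {v z' : Site 2} (hz' : z' ∈ (intDom m).J) (hv : v ∈ (intDom m).Tp ∪ (intDom m).Jabove z')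
    (hv0 : v 0 = m) (hne : v ≠ z') : z' 1 < v 1 := by
  have hzJ := (mem_intDom_J.1 hz').2
  obtain ⟨hz0, hz1, hz2⟩ := hzJ
  have hne1 : v 1 ≠ z' 1 := fun h => hne (by
    ext i; fin_cases i
    · exact hv0.trans hz0.symm
    · exact h)
  simp only [Finset.mem_union, mem_intDom_Tp, JDomain.mem_Jabove] at hv
  rcases hv with ⟨-, -, h⟩ | ⟨-, h⟩
  · rcases h with ⟨h1, h2⟩ | ⟨-, h2⟩
    · omega
    · exact lt_of_le_of_ne (by omega) (Ne.symm hne1)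
  · exact h

namespace IntTermFence

variable {m k : ℕ} {c : Finset (Site 2)} {z : Site 2} {ω : SiteConfig (Site 2)} {S : Set (Site 2)}
  (T : IntTermFence m c z k ω S)

/-- **F-low, internal extremity: the connection of a term does not enter `above c'` for a higher
crossing `c'` it avoids** (`m ≥ 5`, tip `z` at distance `> 2k + 1` from the lower corner and with
`z₁ + 2k + 1 < 0`): following `F` to its first site inside `Λ_m`, the last half-annulus site would
be a boundary site on the tip side in `above c'`, hence top-type for `z'`, hence strictly above the
row of `z'` — but `F` stays within `2k + 1` rows of `z` (tip `z` middle: `-m + 2k + 1 ≤ z₁ ≤ -(2k+1)`). [cite: Nolin2008, §4.4 Lemma 15 (proof), internal extremities (arXiv 0711.4948: Lemma 14)] -/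
theorem not_mem_above_of_row_lt (hm : 5 ≤ m) (hk : 1 ≤ k) (hz : IsIntJ m z) (htk : -(m : ℤ) + 2 * k + 1 ≤ z 1 ∧ z 1 ≤ -(2 * (k : ℤ) + 1))
    {c' : Finset (Site 2)} {z' : Site 2} (hc' : (intDom m).IsCrossing c' z') (hrow : z 1 + (2 * k + 1) < z' 1)
    (hdisj : ∀ v ∈ T.F, v ∉ c') {x : Site 2} (hx : x ∈ T.F) (hxn : (m : ℤ) ≤ triNorm x) : x ∉ (intDom m).above c' z' := by
  intro hxa
  have hcut := intDom_cutProp hm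
  obtain ⟨x', e, hx'n, hen, -, hadj, hpath⟩ := T.exists_exit hk hz htk hx hxn
  -- the half-annulus stretch runs in `D ∖ c'`, so `x'` is above `c'`
  have hsub : {v | (m : ℤ) ≤ triNorm v} ∩ T.F ⊆ (↑((intDom m).D \ c') : Set (Site 2)) := by
    rintro v ⟨hvn, hvF⟩
    rw [Finset.coe_sdiff]
    exact ⟨(mem_intFenceSet_inside (T.F_subset hvF) hvn).1, fun h => hdisj v hvF h⟩
  have hx'F : x' ∈ T.F := hpath.right_mem.2
  have hx'a : x' ∈ (intDom m).above c' z' := JDomain.mem_above_of_pathIn' hxa (hpath.mono hsub)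
  have hx'T : x' ∈ haFin m := (mem_intFenceSet_inside (T.F_subset hx'F) hx'n).1
  have hx'b : triNorm x' = m := by have := triNorm_le_triNorm_add_one_of_adj hadj.symm; omega
  have hbox := intFenceSet_box (T.F_subset hx'F)
  obtain ⟨hz0, hz1, hz2⟩ := hz
  -- `x'` lies on the tip side (it is in the box about `z`, of norm `m`)
  have hx'0 : x' 0 = m ∨ x' 1 = -(m : ℤ) := by
    have h := triNorm_le_iff_lin.1 hx'b.le
    have h' := le_triNorm_iff_lin.1 hx'b.ge
    have hk' : (1 : ℤ) ≤ k := by exact_mod_cast hk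
    rcases h' with h' | h' | h' | h' | h' | h' <;> first | (left; omega) | (right; omega)
  have hne : x' ≠ z' := fun h => hdisj x' hx'F (h ▸ hc'.tip_mem)
  rcases int_sType_or_nType hx'T hx'b hx'0 hc'.tip_mem_J hne with hS | hN
  · exact hc'.not_mem_above_of_mem_Bt_union hcut hS hx'a
  · rcases hx'0 with h0 | h1
    · have h1 := int_row_lt_of_nType hc'.tip_mem_J hN h0 hne
      omega
    · -- the lower side is of bottom type
      have hBt : x' ∈ (intDom m).Bt ∪ (intDom m).Jbelow z' := by
        simp only [Finset.mem_union, mem_intDom_Bt]; exact Or.inl ⟨hx'T, hx'b, Or.inl h1⟩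
      exact hc'.not_mem_above_of_mem_Bt_union hcut hBt hx'a

end IntTermFence

/-! ### Existence from raw success; the rings -/

namespace IntRawOK

variable {m k : ℕ} {c : Finset (Site 2)} {z : Site 2} {ω : SiteConfig (Site 2)}

/-- **The fence with a stopping set** from raw success (`m ≥ 5`, `1 ≤ k`, middle tip). [cite: Nolin2008, §4.4 Lemma 15 (proof), internal extremities (arXiv 0711.4948: Lemma 14)] [cite: Kesten1987, Lemma 2] -/
theorem exists_fence_gen (h : IntRawOK m c z k ω) (hm : 5 ≤ m) (hk : 1 ≤ k) (hc : (intDom m).IsCrossing c z)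
    (htk : -(m : ℤ) + 2 * k + 1 ≤ z 1 ∧ z 1 ≤ -(2 * (k : ℤ) + 1)) {S : Set (Site 2)} (hcS : (↑c : Set (Site 2)) ⊆ S)
    (hSn : ∀ v ∈ S, (m : ℤ) ≤ triNorm v) :
    ∃ mm : Site 2, OpenVCrossThrough (triStrip (z 0 - 2 * k) (z 1 + k) k k) (z 1 + k) (z 1 + 2 * k) ω mm ∧
      ∃ q ∈ S, ∃ p : Site 2, triGraph.Adj q p ∧
        PathIn triGraph ((intFrameZone m z k ∩
          {v | ((m : ℤ) ≤ triNorm v → v ∈ (intDom m).above c z) ∧ (triNorm v < m → z 1 < v 1)}) ∩ ω ∩ Sᶜ) p mm := by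
  obtain ⟨ω', hagree, hω'⟩ := h
  exact int_exists_fence_gen hm hk hc htk hagree hω'.1.1.1 hcS hSn

/-- **A raw-good term has an inner fence stopped at any `S ⊇ c` of half-annulus sites.** [cite: Nolin2008, §4.4 Lemma 15 (proof), internal extremities (arXiv 0711.4948: Lemma 14)] [cite: Kesten1987, Lemma 2] -/
theorem nonempty_intTermFence (h : IntRawOK m c z k ω) (hm : 5 ≤ m) (hk : 1 ≤ k) (hc : (intDom m).IsCrossing c z)
    (htk : -(m : ℤ) + 2 * k + 1 ≤ z 1 ∧ z 1 ≤ -(2 * (k : ℤ) + 1)) {S : Set (Site 2)} (hcS : (↑c : Set (Site 2)) ⊆ S)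
    (hSn : ∀ v ∈ S, (m : ℤ) ≤ triNorm v) : Nonempty (IntTermFence m c z k ω S) := by
  obtain ⟨m', hV, q, hqS, p, hqp, hpath⟩ := h.exists_fence_gen hm hk hc htk hcS hSn
  obtain ⟨F, hF, hp, ht⟩ := hpath.exists_support
  exact ⟨{ m' := m', q := q, p := p, F := F, vcross := hV, q_mem := hqS, adj := hqp, F_subset := hF, path := hp, tight := ht }⟩

/-- **Inner ring, box form.** [cite: Nolin2008, §4.4 Lemma 15 (proof) (arXiv 0711.4948: Lemma 14)] -/
theorem not_box3_of_offLower (h : IntRawOK m c z k ω) (hk : 1 ≤ k) {A : Set (Site 2)}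
    (hA : A ⊆ ((↑((intDom m).lower c z) : Set (Site 2))ᶜ ∩ ω)) {x t : Site 2} (hp : PathIn triGraph A x t)
    (ht : t 0 ≤ z 0 - 7 * k ∨ z 0 + 7 * k ≤ t 0 ∨ t 1 ≤ z 1 - 7 * k ∨ z 1 + 7 * k ≤ t 1) :
    ¬ (z 0 - 3 * k ≤ x 0 ∧ x 0 ≤ z 0 + 3 * k ∧ z 1 - 3 * k ≤ x 1 ∧ x 1 ≤ z 1 + 3 * k) :=
  fun hx => h.inner_ring hk hx ht (hp.mono hA)

/-- **Outer ring, box form.** [cite: Nolin2008, §4.4 Lemma 15 (proof) (arXiv 0711.4948: Lemma 14)] -/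
theorem not_box17_of_offLower (h : IntRawOK m c z k ω) (hk : 1 ≤ k) {A : Set (Site 2)}
    (hA : A ⊆ ((↑((intDom m).lower c z) : Set (Site 2))ᶜ ∩ ω)) {x t : Site 2} (hp : PathIn triGraph A x t)
    (ht : t 0 ≤ z 0 - 31 * k ∨ z 0 + 31 * k ≤ t 0 ∨ t 1 ≤ z 1 - 31 * k ∨ z 1 + 31 * k ≤ t 1) :
    ¬ (z 0 - 17 * k ≤ x 0 ∧ x 0 ≤ z 0 + 17 * k ∧ z 1 - 17 * k ≤ x 1 ∧ x 1 ≤ z 1 + 17 * k) :=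
  fun hx => h.outer_ring hk hx ht (hp.mono hA)

/-- **A higher open crossing off `lower c z` has its tip more than `17k` rows above `z`**
(`4 · 16k < m`: the start of `c'` on the cut rays or on `∂Λ_{2m}` is outside the `31k`-box). [cite: Nolin2008, §4.4 Lemma 15 (proof), internal extremities (arXiv 0711.4948: Lemma 14)] -/
theorem row_gap (h : IntRawOK m c z k ω) (hk : 1 ≤ k) (hkm : 4 * (16 * k) < m)
    (hc : (intDom m).IsCrossing c z) {c' : Finset (Site 2)} {z' : Site 2}
    (hc' : (intDom m).IsCrossing c' z') (hc'ω : (↑c' : Set (Site 2)) ⊆ ω)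
    (hoff : ∀ v ∈ c', v ∉ (intDom m).lower c z) (hlt : z 1 < z' 1) : z 1 + 17 * k < z' 1 := by
  obtain ⟨f, hfc', hfF⟩ := hc'.exists_start
  obtain ⟨hz0, hz1, hz2⟩ := (mem_intDom_J.1 hc.tip_mem_J).2
  obtain ⟨hz'0, hz'1, hz'2⟩ := (mem_intDom_J.1 hc'.tip_mem_J).2
  have hfar := start_far_from_ends (R := 16 * k) hkm hfF (z 1) ⟨by omega, by omega⟩
  have hA : (↑c' : Set (Site 2)) ⊆ ((↑((intDom m).lower c z) : Set (Site 2))ᶜ ∩ ω) :=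
    fun v hv => ⟨fun h' => hoff v (Finset.mem_coe.1 hv) (Finset.mem_coe.1 h'), hc'ω hv⟩
  have hnot := h.not_box17_of_offLower hk hA (hc'.conn z' hc'.tip_mem f hfc') (by push_cast at hfar ⊢; omega)
  by_contra hle
  exact hnot ⟨by omega, by omega, by omega, by omega⟩

/-- **A higher open connected crossing off `lower c z` avoids the `3k`-box** (`4 · 4k < m`). [cite: Nolin2008, §4.4 Lemma 15 (proof), internal extremities (arXiv 0711.4948: Lemma 14)] -/
theorem not_box3_of_crossing (h : IntRawOK m c z k ω) (hk : 1 ≤ k) (hkm : 4 * (4 * k) < m)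
    (hc : (intDom m).IsCrossing c z) {c' : Finset (Site 2)} {z' : Site 2}
    (hc' : (intDom m).IsCrossing c' z') (hc'ω : (↑c' : Set (Site 2)) ⊆ ω)
    (hoff : ∀ v ∈ c', v ∉ (intDom m).lower c z) {x : Site 2} (hx : x ∈ c') :
    ¬ (z 0 - 3 * k ≤ x 0 ∧ x 0 ≤ z 0 + 3 * k ∧ z 1 - 3 * k ≤ x 1 ∧ x 1 ≤ z 1 + 3 * k) := by
  obtain ⟨f, hfc', hfF⟩ := hc'.exists_start
  obtain ⟨hz0, hz1, hz2⟩ := (mem_intDom_J.1 hc.tip_mem_J).2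
  have hfar := start_far_from_ends (R := 4 * k) hkm hfF (z 1) ⟨by omega, by omega⟩
  have hA : (↑c' : Set (Site 2)) ⊆ ((↑((intDom m).lower c z) : Set (Site 2))ᶜ ∩ ω) :=
    fun v hv => ⟨fun h' => hoff v (Finset.mem_coe.1 hv) (Finset.mem_coe.1 h'), hc'ω hv⟩
  exact h.not_box3_of_offLower hk hA (hc'.conn x hx f hfc') (by push_cast at hfar ⊢; omega)

end IntRawOK

/-- **The connection of a term avoids a higher crossing off `lower c z`** (`16k < m`): the sites
of `intFenceSet` lie in the `(2k+1)`-box, inside the `3k`-box for `k ≥ 1`. [cite: Nolin2008, §4.4 Lemma 15 (proof), internal extremities (arXiv 0711.4948: Lemma 14)] -/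
theorem IntTermFence.not_mem_of_offLower {m k : ℕ} {c : Finset (Site 2)} {z : Site 2} {ω : SiteConfig (Site 2)}
    {S : Set (Site 2)} (T : IntTermFence m c z k ω S) (h : IntRawOK m c z k ω) (hk : 1 ≤ k) (hkm : 4 * (4 * k) < m)
    (hc : (intDom m).IsCrossing c z) {c' : Finset (Site 2)} {z' : Site 2}
    (hc' : (intDom m).IsCrossing c' z') (hc'ω : (↑c' : Set (Site 2)) ⊆ ω)
    (hoff : ∀ v ∈ c', v ∉ (intDom m).lower c z) {x : Site 2} (hx : x ∈ T.F) : x ∉ c' := by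
  intro hxc'
  have hb := intFenceSet_box (T.F_subset hx)
  exact h.not_box3_of_crossing hk hkm hc hc' hc'ω hoff hxc' ⟨by omega, by omega, by omega, by omega⟩

end Literature.Probability.Percolation
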